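import Summits.RiemannHypothesis.RiemannHypothesis.Theorems.SignConeGradedFamilyDefs
import Summits.RiemannHypothesis.RiemannHypothesis.Theorems.SignConeGapRungOneErasure

/-!
# Dirty gaps below `log 13` are free, in any number (gap-count ladder, every rung `m`, every cutoff)
(crux `SignConeInequality`, stmt-RiemannHypothesis-16301; cell `Cruxes/SignConeInequality/`, vocabulary `GapConfinedAt` of
`SignConeGradedFamilyDefs`)

The erasure theorem `unitSlack_of_clean_beyond_thirteen_fifths` (plain certificate `pwCert13s`, `SignConeGapRungOneErasure.lean`)
needs `Re F ≥ 0` only beyond `|x| = 13/5 > log 13`; hence EVERY dirty set `S ⊆ {0, …, 12}` is admissible at every cutoff: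
`gapConfinedAt_of_le_twelve`.  For the "push `m`" programme (`gapRung_succ_of` in `SignConeGradedFamily.lean`) this settles,
at every rung `m`, all dirty sets made of gaps `n ≤ 12`; the first gap set NOT covered by a landed theorem is `{n₁, n₂}` with
`n₂ ≥ 13` (two excursions: neither the one-excursion lever `singleGap_lever` nor erasure below `13/5` applies).
-/

noncomputable section

-- `Summit.RiemannHypothesis.RiemannHypothesis.…` repeats a namespace component by design (D-0017 layout).
set_option linter.dupNamespace false

open scoped BigOperators ComplexConjugate

namespace Summit.RiemannHypothesis.RiemannHypothesis.Theorems.SignCone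

open Literature.NumberTheory.LFunctions

/-- **Any number of dirty node gaps below `log 13`, every cutoff**: if every `n ∈ S` has `n ≤ 12` then `GapConfinedAt S a`
for all `a` (erasure with `pwCert13s`; `13/5 > log 13`). [folklore] -/
theorem gapConfinedAt_of_le_twelve {S : Finset ℕ} (hS : ∀ n ∈ S, n ≤ 12) (a : ℝ) : GapConfinedAt S a := by
  intro k g hg F hn hconf M
  refine unitSlack_of_clean_beyond_thirteen_fifths (g := g) (F := F) rfl (fun i => (hg i).1) hn fun x hx => ?_
  have h13 := log_thirteen_lt
  have h2 : Real.log 2 ≤ |x| := by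
    have := Real.log_two_lt_d9
    linarith
  by_contra hneg
  push Not at hneg
  obtain ⟨n, hnS, _, hlt⟩ := hconf x h2 hneg
  have hn13 : (n : ℝ) + 1 ≤ 13 := by exact_mod_cast (show n + 1 ≤ 13 by have := hS n hnS; omega)
  have hlog : Real.log ((n : ℝ) + 1) ≤ Real.log 13 := Real.log_le_log (by positivity) hn13
  linarith

end Summit.RiemannHypothesis.RiemannHypothesis.Theorems.SignCone

end
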